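import Summits.Ventures.PercRepro.Night2ThreeTwoPlane

/-!
# PercRepro — the cell `(2, 1)` with two fat closures: the bases with at most two points on the plane lose nothing
(night-2, gen 27)

Groundwork for the `(2, 1)` nested residue of the `(7, 5)` shadow row (`d = |E ∖ G| = 2`, one coloop, `V = G ∖ K` of
rank `5`).  Two fat closures `H₀ = cl B₀`, `H₁ = cl B₁` (thin members missing at most two points each, distinct
hyperplanes of `G`) meet, off the coloop, in a plane `P = (H₀ ∩ H₁) ∖ K` of rank `≤ 3` with `≥ n − 4` points; the
points off `P` are the at most four points of `(G ∖ H₀) ∪ (G ∖ H₁)`.  A covering basis `X` of a target (five points of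
`V`) with at most two points on `P` loses nothing: its faces at the plane points are not members
(their complements lie in `P` plus one point, rank `≤ 4`, against the span condition `rk (G ∖ B) ≥ 5` of the cell),
and its faces at the off-plane points are members only at the points outside the hyperplane through `P` and the one
off-plane point of `V ∖ X` — at most two of them — so `L1 (K ∪ X) ≤ 2 · 7/24 = 7/12 < 11/18 ≤ capS (K ∪ X)`.

* `five_le_rkN_sdiff_of_mem_Uq_two`: the span condition at `d = 2`;
* `rkN_clF_sdiff_coloops_le_four_two`: the closure of a member has rank `≤ 4` off the coloop;
* `rkN_inter_sdiff_coloops_le_three_of_hyperplanes_two`: two distinct hyperplanes meet, off the coloop, in rank `≤ 3`;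
* `req_le_of_thin_two_one`, `capS_ge_eleven_eighteenths_two_one`: the requests and capacities of the cell;
* **`faceLoss_sum_eq_zero_of_two_off_plane`**: the bases with `≤ 2` points on the plane lose nothing.
-/

namespace PercRepro.Shadow

open Finset PerFlat ThmH

variable {α : Type*} [DecidableEq α] {M : Matroid α} [M.Finite]

section TwoOneTypes

variable {G : Finset α}

/-- **THE COMPLEMENT OF A MEMBER SPANS** at `d = 2`: `7 = ρ(E ∖ B) ≤ ρ(E ∖ G) + ρ(G ∖ B) ≤ 2 + ρ(G ∖ B)`. -/
theorem five_le_rkN_sdiff_of_mem_Uq_two (hG : G ∈ flatsQ M (5 + 1)) (hd : (gr M \ G).card = 2) {B : Finset α}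
    (hB : B ∈ Uq M (5 + 2) 5) (hBG : B ⊆ G) : 5 ≤ rkN M (G \ B) := by
  have hGg : G ⊆ gr M := (mem_flatsQ.1 hG).1
  obtain ⟨-, -, h7⟩ := mem_Uq.1 hB
  have h7' : rkN M (gr M \ B) = 7 := by
    rw [eRk_eq_rkN] at h7
    exact_mod_cast h7
  have hunion : gr M \ B = (gr M \ G) ∪ (G \ B) := by
    ext a
    simp only [Finset.mem_sdiff, Finset.mem_union]
    constructor
    · rintro ⟨hag, haB⟩
      by_cases haG : a ∈ G
      · exact Or.inr ⟨haG, haB⟩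
      · exact Or.inl ⟨hag, haG⟩
    · rintro (⟨hag, haG⟩ | ⟨haG, haB⟩)
      · exact ⟨hag, fun h => haG (hBG h)⟩
      · exact ⟨hGg haG, haB⟩
  have hsub := rkN_submod (M := M) (gr M \ G) (G \ B)
  have hD : rkN M (gr M \ G) ≤ 2 := by
    have := rkN_le_card (M := M) (gr M \ G)
    omega
  rw [← hunion, h7'] at hsub
  omega

/-- The closure of a member of the cell `(2, 1)` has rank `4` off the coloop. -/
theorem rkN_clF_sdiff_coloops_le_four_two (hG : G ∈ flatsQ M (5 + 1)) (hd : (gr M \ G).card = 2)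
    (hk : kColoops M G = 1) {B : Finset α} (hB : B ∈ thinMembers M 5 G) :
    rkN M (clF M B \ coloops M G) ≤ 4 := by
  have hd' : (gr M \ G).card ≤ 5 := by omega
  have hGg : G ⊆ gr M := (mem_flatsQ.1 hG).1
  have hB' : B ∈ membersIn M (Uq M (5 + 2) 5) G := (mem_thinMembers.1 hB).1
  have hBU : B ∈ Uq M (5 + 2) 5 := (mem_membersIn.1 hB').1
  have hHG : clF M B ⊆ G := (mem_membersIn.1 hB').2
  have hKB : coloops M G ⊆ B := coloops_subset_of_mem_thinMembers hG hd' hB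
  have hKH : coloops M G ⊆ clF M B := hKB.trans (subset_clF hBU)
  have h5 : rkN M (clF M B) = 5 := rkN_clF_eq_five_of_mem_Uq hBU
  have h := eRk_eq_kColoops_add_sdiff hGg hHG hKH
  rw [eRk_eq_rkN, eRk_eq_rkN, hk, h5] at h
  have h' : ((5 : ℕ) : ℕ∞) = ((1 + rkN M (clF M B \ coloops M G) : ℕ) : ℕ∞) := by
    rw [Nat.cast_add]; exact_mod_cast h
  have h'' : 5 = 1 + rkN M (clF M B \ coloops M G) := by exact_mod_cast h'
  omega

/-- **Two distinct hyperplanes of `G` meet, off the coloop, in rank `≤ 3`** (cell `(2, 1)`). -/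
theorem rkN_inter_sdiff_coloops_le_three_of_hyperplanes_two (hG : G ∈ flatsQ M (5 + 1)) (hk : kColoops M G = 1)
    {H H' : Finset α} (hHG : H ⊆ G) (hH'G : H' ⊆ G) (hHcl : clF M H = H) (hH5 : rkN M H = 5)
    (hH'5 : rkN M H' ≤ 5) (hKH : coloops M G ⊆ H) (hKH' : coloops M G ⊆ H') {y : α} (hyH' : y ∈ H')
    (hyH : y ∉ H) : rkN M ((H ∩ H') \ coloops M G) ≤ 3 := by
  have hGg : G ⊆ gr M := (mem_flatsQ.1 hG).1
  have hU6 : 6 ≤ rkN M (H ∪ H') := by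
    have h1 : rkN M (insert y H) = rkN M H + 1 :=
      rkN_insert_of_notMem_clF (hGg (hH'G hyH')) (by rw [hHcl]; exact hyH)
    have h2 : insert y H ⊆ H ∪ H' := Finset.insert_subset (Finset.mem_union_right _ hyH') Finset.subset_union_left
    have := rkN_mono (M := M) h2
    omega
  have hsub := rkN_submod (M := M) H H'
  have hKI : coloops M G ⊆ H ∩ H' := Finset.subset_inter hKH hKH'
  have hIG : H ∩ H' ⊆ G := Finset.inter_subset_left.trans hHG
  have h := eRk_eq_kColoops_add_sdiff hGg hIG hKI
  rw [eRk_eq_rkN, eRk_eq_rkN, hk] at h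
  have h' : ((rkN M (H ∩ H') : ℕ) : ℕ∞) = ((1 + rkN M ((H ∩ H') \ coloops M G) : ℕ) : ℕ∞) := by
    rw [Nat.cast_add]; exact_mod_cast h
  have h'' : rkN M (H ∩ H') = 1 + rkN M ((H ∩ H') \ coloops M G) := by exact_mod_cast h'
  omega

/-- In the cell `d = 2` a thin member requests at most `7/24`. -/
theorem req_le_of_thin_two_one (hG : G ∈ flatsQ M (5 + 1)) (hd : (gr M \ G).card = 2) {B : Finset α}
    (hB : B ∈ thinMembers M 5 G) : req M 5 B ≤ 7 / 24 := by
  have hd' : (gr M \ G).card ≤ 5 := by omega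
  have hm2 : 2 ≤ (G \ clF M B).card :=
    two_le_card_sdiff_of_not_lay0 hG hd' (mem_thinMembers.1 hB).1 (mem_thinMembers.1 hB).2
  rw [req_eq_of_thin hG hB, hd]
  have h2 : (2 : ℚ) ≤ ((G \ clF M B).card : ℚ) := by exact_mod_cast hm2
  unfold phiQ
  push_cast
  rw [div_le_div_iff₀ (by linarith) (by norm_num)]
  linarith

/-- In the cell `(2, 1)` the capacity of every subset of `G` is at least `11/18`. -/
theorem capS_ge_eleven_eighteenths_two_one (hd : (gr M \ G).card = 2) (hk : kColoops M G = 1) {S : Finset α}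
    (hSG : S ⊆ G) : (11 / 18 : ℚ) ≤ capS M 5 G S := by
  have h := capS_ge_one_sub_kColoops (q := 5) hd hSG
  rw [hk] at h
  unfold phiQ at h
  norm_num at h
  exact h

open scoped Classical in
/-- **THE BASES WITH AT MOST TWO POINTS ON THE PLANE LOSE NOTHING** (cell `(2, 1)`, two fat closures `cl B₀ ≠ cl B₁`
missing `≤ 2` points each): for a `5`-subset `X ⊆ V` with `|X ∩ P| ≤ 2`, `P = (cl B₀ ∩ cl B₁) ∖ K`, the face losses
of `K ∪ X` vanish (no independence of `X` is needed). -/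
theorem faceLoss_sum_eq_zero_of_two_off_plane (hG : G ∈ flatsQ M (5 + 1)) (hd : (gr M \ G).card = 2)
    (hk : kColoops M G = 1) {B₀ B₁ : Finset α} (hB₀ : B₀ ∈ thinMembers M 5 G) (hB₁ : B₁ ∈ thinMembers M 5 G)
    (hm₀ : (G \ clF M B₀).card ≤ 2) (hm₁ : (G \ clF M B₁).card ≤ 2) (hne : clF M B₀ ≠ clF M B₁)
    {X : Finset α} (hXV : X ⊆ G \ coloops M G) (hX5 : X.card = 5)
    (hXP : (X ∩ ((clF M B₀ ∩ clF M B₁) \ coloops M G)).card ≤ 2) :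
    ∑ w ∈ X, faceLoss M 5 G (coloops M G ∪ X) w = 0 := by
  have hd' : (gr M \ G).card ≤ 5 := by omega
  have hGg : G ⊆ gr M := (mem_flatsQ.1 hG).1
  have hKG : coloops M G ⊆ G := fun y hy => (mem_coloops.1 hy).1
  -- the two hyperplanes
  have hB₀' : B₀ ∈ membersIn M (Uq M (5 + 2) 5) G := (mem_thinMembers.1 hB₀).1
  have hB₁' : B₁ ∈ membersIn M (Uq M (5 + 2) 5) G := (mem_thinMembers.1 hB₁).1
  have hB₀U : B₀ ∈ Uq M (5 + 2) 5 := (mem_membersIn.1 hB₀').1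
  have hB₁U : B₁ ∈ Uq M (5 + 2) 5 := (mem_membersIn.1 hB₁').1
  set H₀ := clF M B₀ with hH₀
  set H₁ := clF M B₁ with hH₁
  have hH₀G : H₀ ⊆ G := (mem_membersIn.1 hB₀').2
  have hH₁G : H₁ ⊆ G := (mem_membersIn.1 hB₁').2
  have hKH₀ : coloops M G ⊆ H₀ := (coloops_subset_of_mem_thinMembers hG hd' hB₀).trans (subset_clF hB₀U)
  have hKH₁ : coloops M G ⊆ H₁ := (coloops_subset_of_mem_thinMembers hG hd' hB₁).trans (subset_clF hB₁U)
  have hH₀5 : rkN M H₀ = 5 := rkN_clF_eq_five_of_mem_Uq hB₀U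
  have hH₁5 : rkN M H₁ = 5 := rkN_clF_eq_five_of_mem_Uq hB₁U
  have hH₀cl : clF M H₀ = H₀ := clF_clF B₀
  have hH₁cl : clF M H₁ = H₁ := clF_clF B₁
  -- the plane `P` has rank `≤ 3`
  set P := (H₀ ∩ H₁) \ coloops M G with hP
  have hPr : rkN M P ≤ 3 := by
    by_cases hsub : H₁ ⊆ H₀
    · -- then some point of `H₀` is outside `H₁`
      have hex : ∃ y ∈ H₀, y ∉ H₁ := by
        by_contra hcon
        push Not at hcon
        exact hne (Finset.Subset.antisymm hcon hsub)
      obtain ⟨y, hyH₀, hyH₁⟩ := hex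
      have := rkN_inter_sdiff_coloops_le_three_of_hyperplanes_two hG hk hH₁G hH₀G hH₁cl hH₁5 hH₀5.le hKH₁ hKH₀
        hyH₀ hyH₁
      rwa [Finset.inter_comm] at this
    · obtain ⟨y, hyH₁, hyH₀⟩ := Finset.not_subset.1 hsub
      exact rkN_inter_sdiff_coloops_le_three_of_hyperplanes_two hG hk hH₀G hH₁G hH₀cl hH₀5 hH₁5.le hKH₀ hKH₁
        hyH₁ hyH₀
  have hPV : P ⊆ G \ coloops M G :=
    Finset.sdiff_subset_sdiff (Finset.inter_subset_left.trans hH₀G) (Finset.Subset.refl _)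
  -- the points off the plane: `Xs = V ∖ P = (G ∖ H₀) ∪ (G ∖ H₁)`, at most four
  set Xs := (G \ H₀) ∪ (G \ H₁) with hXs
  have hVP : (G \ coloops M G) \ P = Xs := by
    ext a
    simp only [hP, hXs, Finset.mem_sdiff, Finset.mem_inter, Finset.mem_union, not_and, not_not]
    constructor
    · rintro ⟨⟨haG, haK⟩, h⟩
      by_cases h0 : a ∈ H₀
      · by_cases h1 : a ∈ H₁
        · exact absurd (h ⟨h0, h1⟩) haK
        · exact Or.inr ⟨haG, h1⟩
      · exact Or.inl ⟨haG, h0⟩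
    · rintro (⟨haG, h0⟩ | ⟨haG, h1⟩)
      · exact ⟨⟨haG, fun haK => h0 (hKH₀ haK)⟩, fun h => absurd h.1 h0⟩
      · exact ⟨⟨haG, fun haK => h1 (hKH₁ haK)⟩, fun h => absurd h.2 h1⟩
  have hXscard : Xs.card ≤ 4 := by
    have := Finset.card_union_le (G \ H₀) (G \ H₁)
    rw [← hXs] at this
    omega
  -- `X` has at least three points off the plane, so at most one point of `Xs` is outside `X`
  have hXoff : 3 ≤ (X \ P).card := by
    have := Finset.card_sdiff_add_card_inter X P
    omega
  have hXXs : X \ P ⊆ Xs := by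
    rw [← hVP]; exact Finset.sdiff_subset_sdiff hXV (Finset.Subset.refl _)
  have hXsX : (Xs \ X).card ≤ 1 := by
    have h1 : (X \ P) ⊆ Xs ∩ X := Finset.subset_inter hXXs Finset.sdiff_subset
    have h2 := Finset.card_le_card h1
    have h3 := Finset.card_sdiff_add_card_inter Xs X
    omega
  set Q := coloops M G ∪ X with hQ
  have hXK : Disjoint X (coloops M G) := by
    rw [Finset.disjoint_left]; intro a ha haK
    exact (Finset.mem_sdiff.1 (hXV ha)).2 haK
  have hQG : Q ⊆ G := Finset.union_subset hKG (hXV.trans Finset.sdiff_subset)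
  have hKQ : coloops M G ⊆ Q := Finset.subset_union_left
  have hQK : Q \ coloops M G = X := by
    rw [hQ, Finset.union_sdiff_left, Finset.sdiff_eq_self_of_disjoint hXK]
  -- the complement of a face at `w`: `G ∖ (Q ∖ w) ⊆ P ∪ (Xs ∖ X) ∪ {w}`
  have hcompl : ∀ w ∈ X, G \ Q.erase w ⊆ insert w (P ∪ (Xs \ X)) := by
    intro w hw a ha
    rw [Finset.mem_sdiff, Finset.mem_erase, not_and] at ha
    rw [Finset.mem_insert, Finset.mem_union]
    by_cases haw : a = w
    · exact Or.inl haw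
    · have haQ : a ∉ Q := ha.2 haw
      have haK : a ∉ coloops M G := fun h => haQ (hKQ h)
      have haX : a ∉ X := fun h => haQ (Finset.mem_union_right _ h)
      by_cases haP : a ∈ P
      · exact Or.inr (Or.inl haP)
      · right; right
        rw [← hVP, Finset.mem_sdiff]
        exact ⟨Finset.mem_sdiff.2 ⟨Finset.mem_sdiff.2 ⟨ha.1, haK⟩, haP⟩, haX⟩
  -- a face whose complement has rank `≤ 4` is not a member
  have hnotmem : ∀ w ∈ X, rkN M (insert w (P ∪ (Xs \ X))) ≤ 4 → Q.erase w ∉ Uq M (5 + 2) 5 := by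
    intro w hw hr hB
    have hBG : Q.erase w ⊆ G := (Finset.erase_subset w Q).trans hQG
    have h5 := five_le_rkN_sdiff_of_mem_Uq_two hG hd hB hBG
    have := rkN_mono (M := M) (hcompl w hw)
    omega
  -- the faces at the plane points are not members
  have hface_plane : ∀ w ∈ X, w ∈ P → Q.erase w ∉ Uq M (5 + 2) 5 := by
    intro w hw hwP
    apply hnotmem w hw
    have h1 : insert w (P ∪ (Xs \ X)) = P ∪ (Xs \ X) := Finset.insert_eq_of_mem (Finset.mem_union_left _ hwP)
    rw [h1]
    have := rkN_union_le_add_card (M := M) P (Xs \ X)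
    omega
  -- the thin covering preimages of `Q`: faces at off-plane points only, at most two of them
  have hL1 : L1 M 5 G Q ≤ 7 / 12 := by
    unfold L1
    set Pre := (coverPreimages M (Uq M (5 + 2) 5) G Q).filter (fun B => B ∉ lay0 M 5 G) with hPre
    have hthin : ∀ B ∈ Pre, B ∈ thinMembers M 5 G := by
      intro B hB
      rw [hPre, Finset.mem_filter, mem_coverPreimages] at hB
      exact mem_thinMembers.2 ⟨hB.1.1, hB.2⟩
    have hreq : ∀ B ∈ Pre, req M 5 B ≤ 7 / 24 := fun B hB => req_le_of_thin_two_one hG hd (hthin B hB)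
    -- every thin preimage is a face `Q ∖ w` at a point `w ∈ X ∖ P` whose face is a member
    have hPsub : Pre ⊆ ((X \ P).filter (fun w => Q.erase w ∈ Uq M (5 + 2) 5)).image (fun w => Q.erase w) := by
      intro B hB
      have h1 := thin_coverPreimages_subset_image_coloops hG hd' Q hB
      rw [hQK] at h1
      obtain ⟨w, hw, rfl⟩ := Finset.mem_image.1 h1
      have hwX : w ∈ X := (mem_coloops.1 hw).1
      have hU : Q.erase w ∈ Uq M (5 + 2) 5 := (mem_membersIn.1 (mem_thinMembers.1 (hthin _ hB)).1).1
      rw [Finset.mem_image]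
      refine ⟨w, Finset.mem_filter.2 ⟨Finset.mem_sdiff.2 ⟨hwX, fun hwP => hface_plane w hwX hwP hU⟩, hU⟩, rfl⟩
    have hPcard : Pre.card ≤ 2 := by
      refine (Finset.card_le_card hPsub).trans (Finset.card_image_le.trans ?_)
      -- the member faces at off-plane points
      by_cases hempty : Xs \ X = ∅
      · -- no point of `Xs` outside `X`: every face at an off-plane point has complement in `P ∪ {w}`
        have hnone : (X \ P).filter (fun w => Q.erase w ∈ Uq M (5 + 2) 5) = ∅ := by
          rw [Finset.filter_eq_empty_iff]
          intro w hw hU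
          apply hnotmem w (Finset.mem_sdiff.1 hw).1 _ hU
          rw [hempty, Finset.union_empty]
          have h1 := rkN_union_le_add_card (M := M) P {w}
          rw [Finset.union_comm, ← Finset.insert_eq, Finset.card_singleton] at h1
          omega
        rw [hnone, Finset.card_empty]; norm_num
      · -- exactly one point `x′` of `Xs` outside `X`; it lies in one of the hyperplanes, say `H`
        obtain ⟨x', hx'⟩ := Finset.nonempty_iff_ne_empty.2 hempty
        have hx'Xs : x' ∈ Xs := (Finset.mem_sdiff.1 hx').1
        have hx'X : x' ∉ X := (Finset.mem_sdiff.1 hx').2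
        have hsingle : Xs \ X = {x'} := by
          apply Finset.eq_singleton_iff_unique_mem.2 ⟨hx', fun y hy => ?_⟩
          have := Finset.card_le_one.1 hXsX y hy x' hx'
          exact this
        -- `x′` lies in `H₀` or in `H₁` (the two missed pairs are disjoint, since `|Xs| ≥ 4`)
        have hXs4 : 4 ≤ Xs.card := by
          have h1 : (X \ P) ∪ (Xs \ X) ⊆ Xs := Finset.union_subset hXXs Finset.sdiff_subset
          have h2 : Disjoint (X \ P) (Xs \ X) := by
            rw [Finset.disjoint_left]; intro a ha hb
            exact (Finset.mem_sdiff.1 hb).2 (Finset.mem_sdiff.1 ha).1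
          have h3 := Finset.card_le_card h1
          rw [Finset.card_union_of_disjoint h2, hsingle, Finset.card_singleton] at h3
          omega
        have hx'K : x' ∉ coloops M G := by
          rw [hXs, Finset.mem_union, Finset.mem_sdiff, Finset.mem_sdiff] at hx'Xs
          rcases hx'Xs with h | h
          · exact fun hK => h.2 (hKH₀ hK)
          · exact fun hK => h.2 (hKH₁ hK)
        -- the general step: with `x′ ∈ H` (`H` one of the two hyperplanes), a member face at `w ∈ X ∖ P` needs `w ∉ H`
        have hkey : ∀ H : Finset α, rkN M (H \ coloops M G) ≤ 4 → P ⊆ H \ coloops M G → x' ∈ H →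
            (X \ P).filter (fun w => Q.erase w ∈ Uq M (5 + 2) 5) ⊆ X ∩ (G \ H) := by
          intro H hHr hPH hx'H w hw
          rw [Finset.mem_filter] at hw
          obtain ⟨hwXP, hU⟩ := hw
          have hwX : w ∈ X := (Finset.mem_sdiff.1 hwXP).1
          rw [Finset.mem_inter, Finset.mem_sdiff]
          refine ⟨hwX, (Finset.mem_sdiff.1 (hXV hwX)).1, fun hwH => ?_⟩
          apply hnotmem w hwX _ hU
          rw [hsingle]
          have hsub : insert w (P ∪ {x'}) ⊆ H \ coloops M G := by
            intro a ha
            rw [Finset.mem_insert, Finset.mem_union, Finset.mem_singleton] at ha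
            rcases ha with rfl | haP | rfl
            · exact Finset.mem_sdiff.2 ⟨hwH, (Finset.mem_sdiff.1 (hXV hwX)).2⟩
            · exact hPH haP
            · exact Finset.mem_sdiff.2 ⟨hx'H, hx'K⟩
          have := rkN_mono (M := M) hsub
          omega
        -- `x′` lies in `H₀` or in `H₁`
        have hx'H : x' ∈ H₀ ∨ x' ∈ H₁ := by
          by_contra hcon
          push Not at hcon
          -- then `x′` is in both missed pairs and `|Xs| ≤ 3`
          have h1 : Xs ⊆ insert x' (((G \ H₀).erase x') ∪ ((G \ H₁).erase x')) := by
            intro a ha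
            rw [hXs, Finset.mem_union] at ha
            rw [Finset.mem_insert, Finset.mem_union, Finset.mem_erase, Finset.mem_erase]
            by_cases hax : a = x'
            · exact Or.inl hax
            · rcases ha with h | h
              · exact Or.inr (Or.inl ⟨hax, h⟩)
              · exact Or.inr (Or.inr ⟨hax, h⟩)
          have h2 := Finset.card_le_card h1
          have h3 := Finset.card_insert_le x' (((G \ H₀).erase x') ∪ ((G \ H₁).erase x'))
          have h4 := Finset.card_union_le ((G \ H₀).erase x') ((G \ H₁).erase x')
          have hx'G : x' ∈ G := by
            rw [hXs, Finset.mem_union, Finset.mem_sdiff, Finset.mem_sdiff] at hx'Xs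
            rcases hx'Xs with h | h <;> exact h.1
          have h5 : ((G \ H₀).erase x').card + 1 = (G \ H₀).card :=
            Finset.card_erase_add_one (Finset.mem_sdiff.2 ⟨hx'G, hcon.1⟩)
          have h6 : ((G \ H₁).erase x').card + 1 = (G \ H₁).card :=
            Finset.card_erase_add_one (Finset.mem_sdiff.2 ⟨hx'G, hcon.2⟩)
          omega
        rcases hx'H with h | h
        · calc ((X \ P).filter (fun w => Q.erase w ∈ Uq M (5 + 2) 5)).card
              ≤ (X ∩ (G \ H₀)).card :=
                Finset.card_le_card (hkey H₀ (rkN_clF_sdiff_coloops_le_four_two hG hd hk hB₀)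
                  (Finset.sdiff_subset_sdiff Finset.inter_subset_left (Finset.Subset.refl _)) h)
            _ ≤ (G \ H₀).card := Finset.card_le_card Finset.inter_subset_right
            _ ≤ 2 := hm₀
        · calc ((X \ P).filter (fun w => Q.erase w ∈ Uq M (5 + 2) 5)).card
              ≤ (X ∩ (G \ H₁)).card :=
                Finset.card_le_card (hkey H₁ (rkN_clF_sdiff_coloops_le_four_two hG hd hk hB₁)
                  (Finset.sdiff_subset_sdiff Finset.inter_subset_right (Finset.Subset.refl _)) h)
            _ ≤ (G \ H₁).card := Finset.card_le_card Finset.inter_subset_right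
            _ ≤ 2 := hm₁
    calc ∑ B ∈ Pre, req M 5 B ≤ ∑ _B ∈ Pre, (7 / 24 : ℚ) := Finset.sum_le_sum hreq
      _ = (Pre.card : ℚ) * (7 / 24) := by rw [Finset.sum_const, nsmul_eq_mul]
      _ ≤ 2 * (7 / 24) := by
          have : (Pre.card : ℚ) ≤ 2 := by exact_mod_cast hPcard
          nlinarith
      _ = 7 / 12 := by norm_num
  have hcap := capS_ge_eleven_eighteenths_two_one hd hk hQG
  have hfS : fS M 5 G Q = 1 := by
    unfold fS
    rw [if_pos (by linarith)]
  apply Finset.sum_eq_zero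
  intro w hw
  unfold faceLoss
  split_ifs with hcond
  · unfold loss
    rw [Finset.insert_erase (Finset.mem_union_right _ hw), hfS]
    ring
  · rfl

end TwoOneTypes

end PercRepro.Shadow
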